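import Summits.ABC.IUTFork.Joshi.ThetaEvaluationLogShells
import Summits.ABC.IUTFork.Joshi.LogShellsJoshi
import HarnessLib

/-!
# [J-III] §9.6–9.7 over §9.1: the crystalline class of a Tate curve read on E-t19's Bloch–Kato signature — merge-debt
# bridge, three claims DISCHARGED, and the `p*_w` normalisation tension between (9.1.1.3)/(9.7.1.1) and (9.7.2.2)

Block-E record file of the abc-iut cell (rung LADDER-ABC:A2.E; seat abc-iut-E-t21, slot T-21, fallback §4 (1) «merge-debt /
DERIVABLE rows»). Source: K. Joshi, *Construction of Arithmetic Teichmüller Spaces III*, arXiv:2401.13508**v4** (UNREFEREED;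
bib `Joshi2024ATS3`; locators «p.N l.M» = PDF page N, line M of the cell's render). TAKES NO SIDE on [IUTchIII] Cor. 3.12, on
Joshi's claims, or on Mochizuki's reports on them; typed ≠ proved; nothing of print is asserted. This file reconciles the two
landed carriers of §9 — abc-iut-E-t19's `Summit.ABC.IUTFork.Joshi.BlochKatoDatum p E H1` (§9.1.1: the Bloch–Kato subspaces and
the decomposition (9.1.1.3) «`H¹(G_E, ℚ_p(1)) ≃ H¹_f ⊕ ℚ_p ≃ E ⊕ ℚ_p`, explicitly `q ↦ (log_E(q), v_E(q))`» as FIELDS) and this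
seat's `ATS3.LocalBKDatum` / `ATS3.TateLocalDatum` (§9.6–9.7: the class `ξ_w`, `e_BK`, `log_BK`, the claims of Lemma 9.6.2.2,
(9.7.2.2), Prop. 9.7.2.3) — by CONSTRUCTING the latter from the former:

* `eBKOfDec D : E ≃ H¹_e` — the Bloch–Kato exponential in the normalisation that (9.1.1.3) prints (`H¹_e = H¹_f ≃ E ⊕ 0`, inverse
  `log_BK = log_E`, which is `log_p` on unit classes, `logE_of_norm_eq_one`); this is also the normalisation of the explicit
  formula of (9.7.1.1), «`x ↦ (e^{p^m·x})^{1/p^m}`» (p.110 l.18–20), whose Kummer class has `log_p = x`.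
* `LocalBKDatum.ofBlochKato D` (standard `p`-adic logarithm `PadicLogOnUnits.ofUnitLog p E` of Literature, Joshi's `p*`,
  `H1Z := ↥D.HZ`, Kummer map extended by junk at `0`) and `TateLocalDatum.ofBlochKato` (adding `ℓ`, `q^{1/2ℓ}`).

RESULTS (kernel, no claim involved beyond E-t19's signature FIELDS, which transcribe [BlochKato1990]/Perrin-Riou as Joshi
recalls them): over the bridged datum this seat's claim-Props `H1eEqH1f` ((9.1.1.4)), `OneUnitsKummerFontaine` (Perrin-Riou
step), `PrincipalUnitsCrystalline` (p.111 l.1–12) and **Lemma 9.6.2.2** (`XiCrystalline`: «`ξ_w ∈ H¹_e(G_{L′_w};K_w, ℤ_p(1))`»)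
are DISCHARGED (`xiCrystalline_ofBlochKato`), and `log_BK(ξ_w) = log_p(1 + p*·q^{1/2ℓ})` lies in `p*·𝒪 ⊆ 𝒪 ⊆ ℐ`, so the
MEMBERSHIP half of (9.7.2.2) / Prop. 9.7.2.3 («`log_BK(ξ) ∈ I((X/L′_w, K_w))`») holds (`logBK_xi_mem_logShell_ofBlochKato`).
NEUTRAL FLAG for the referee lanes (print-internal, no adjudication): the displayed VALUE of (9.7.2.2),
«`log_BK(ξ) = log_p(1 + p*_w·q^{1/2ℓ})/p*_w`» (p.110 l.57–73), differs from the (9.1.1.3)/(9.7.1.1) normalisation by the factor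
`p*_w`: over the bridged datum `LogBKPrincipalUnits` and `LogBKXiFormula` are REFUTED (`not_logBKPrincipalUnits_ofBlochKato`,
`not_logBKXiFormula_ofBlochKato`) — i.e. the two printed normalisations cannot both be read literally; which one print intends
is for E-ref (the set `I = (1/p*)·log(𝒪^*)` of Prop. 9.7.2.3 is the image of the unit classes under `p*⁻¹·log_p`, not under
`log_p`). Standard axioms only; sorry-free.
-/

noncomputable section

open Set Metric
open scoped Pointwise

namespace Summit.ABC.IUTFork.Joshi.ATS3

open Literature.AnabelianGeometry.AbsoluteAnabelian Literature.IUT.LogVolume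

/-- Joshi's `p*` as the power of `p` used by Literature's standard model `PadicLogOnUnits.ofUnitLog`. [folklore] -/
theorem pStar_eq_pow (p : ℕ) : pStar p = p ^ (if p = 2 then 2 else 1) := by
  unfold pStar; split_ifs with h <;> simp [h]

section Bridge

variable {p : ℕ} [Fact p.Prime] {E : Type} [NontriviallyNormedField E] [NormedAlgebra ℚ_[p] E]
  {H1 : Type} [AddCommGroup H1] [Module ℚ_[p] H1] (D : BlochKatoDatum p E H1)

/-- **The Bloch–Kato exponential in the (9.1.1.3) normalisation** ([J-III] p.95 l.20–25 with (9.1.1.4) `H¹_e = H¹_f`, p.95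
l.47–49; (9.7.1.1) p.110 l.8–20): `x ↦ dec⁻¹(x, 0) ∈ H¹_f = H¹_e`, with inverse `c ↦ (dec c).1 = log_E(c)`. DERIVED from E-t19's
fields. [claim: Joshi2024ATS3, status: disputed] -/
@[claim "Joshi2024ATS3" "disputed"]
def eBKOfDec : E ≃ ↥((D.He : Submodule ℚ_[p] H1) : Set H1) where
  toFun x := ⟨D.dec.symm (x, 0), by
    show D.dec.symm (x, 0) ∈ D.He
    rw [D.He_eq_Hf, D.mem_Hf_iff, LinearEquiv.apply_symm_apply]⟩
  invFun c := (D.dec c.1).1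
  left_inv x := by simp
  right_inv c := by
    obtain ⟨c, hc⟩ := c
    have hc' : c ∈ D.Hf := by rw [← D.He_eq_Hf]; exact hc
    have h2 : (D.dec c).2 = 0 := (D.mem_Hf_iff c).1 hc'
    apply Subtype.ext
    show D.dec.symm ((D.dec c).1, 0) = c
    rw [← h2, Prod.mk.eta, LinearEquiv.symm_apply_apply]

open Classical in
/-- The Kummer map `E → H¹(G_E, ℤ_p(1))` (integral classes `D.HZ`, `kummer_mem_HZ`) extended by the junk value `0` at `0`,
as this seat's `LocalBKDatum.kummer` wants it. [claim: Joshi2024ATS3, status: disputed] -/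
@[claim "Joshi2024ATS3" "disputed"]
def kummerZ (x : E) : ↥D.HZ := if h : x = 0 then 0 else ⟨D.kummer (Units.mk0 x h), D.kummer_mem_HZ _⟩

/-- On `x ≠ 0` the extended Kummer map is E-t19's `κ`. [folklore] -/
theorem kummerZ_of_ne_zero {x : E} (hx : x ≠ 0) : (kummerZ D x : H1) = D.kummer (Units.mk0 x hx) := by
  simp [kummerZ, hx]

variable [IsUltrametricDist E] [CompleteSpace E]

/-- **The bridge**: this seat's local Bloch–Kato datum (§9.6–9.7 carrier) BUILT from E-t19's §9.1.1 signature, with the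
standard `p`-adic logarithm of Literature (`PadicLogOnUnits.ofUnitLog p E`: `log = log_p`, `pstar = p*`), Joshi's `p*`
((9.6.1.2)), `H1Z := H¹(G_E, ℤ_p(1))` = `D.HZ`, `H1Q := H1`, `H1e := D.He`, `H1f := D.Hf`, and `e_BK := eBKOfDec D`.
[claim: Joshi2024ATS3, status: disputed] -/
@[claim "Joshi2024ATS3" "disputed"]
def LocalBKDatum.ofBlochKato : LocalBKDatum E (↥D.HZ) H1 where
  toPadicLogOnUnits := PadicLogOnUnits.ofUnitLog p E
  p := p
  prime_p := Fact.out
  pstar_eq_cast := by rw [PadicLogOnUnits.ofUnitLog_pstar, pStar_eq_pow]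
  toQ := Subtype.val
  H1e := D.He
  H1f := D.Hf
  kummer := kummerZ D
  eBK := eBKOfDec D

/-- `log_BK` of the bridged datum is `c ↦ (dec c).1 = log_E(c)` ((9.1.1.3)). [folklore] -/
theorem logBK_ofBlochKato_apply (c : ↥(LocalBKDatum.ofBlochKato D).H1e) :
    (LocalBKDatum.ofBlochKato D).logBK c = (D.dec c.1).1 := rfl

/-- A principal unit (`‖u − 1‖ ≤ ‖p*‖`) has norm one. [folklore] -/
theorem norm_eq_one_of_mem_closedBall_pstar {u : E} (hu : u ∈ closedBall (1 : E) ‖(PadicLogOnUnits.ofUnitLog p E).pstar‖) :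
    ‖u‖ = 1 := by
  have h := closedBall_one_subset_sphere (PadicLogOnUnits.ofUnitLog p E) hu
  rwa [mem_sphere, dist_zero_right] at h

/-- On a unit `u` (`‖u‖ = 1`), `log_BK(κ(u)) = log_p(u)` over the bridged datum ((9.1.1.3) «`q ↦ (log_E(q), v_E(q))`» with
`log_E = log_p` on units). [folklore] -/
theorem logBK_ofBlochKato_kummer {u : E} (h1 : ‖u‖ = 1)
    (he : (LocalBKDatum.ofBlochKato D).toQ ((LocalBKDatum.ofBlochKato D).kummer u) ∈ (LocalBKDatum.ofBlochKato D).H1e) :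
    (LocalBKDatum.ofBlochKato D).logBK ⟨_, he⟩ = unitLog u := by
  have h0 : u ≠ 0 := fun h => by rw [h, norm_zero] at h1; exact zero_ne_one h1
  rw [logBK_ofBlochKato_apply]
  show (D.dec (kummerZ D u : H1)).1 = unitLog u
  rw [kummerZ_of_ne_zero D h0, D.dec_kummer, D.logE_of_norm_eq_one _ (by exact h1)]
  rfl

/-- **(9.1.1.4) DISCHARGED over the bridge**: this seat's claim `H1eEqH1f` holds for `ofBlochKato D` (it is E-t19's field
`He_eq_Hf`). [folklore] -/
theorem h1eEqH1f_ofBlochKato : (LocalBKDatum.ofBlochKato D).H1eEqH1f := by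
  show ((D.He : Submodule ℚ_[p] H1) : Set H1) = ((D.Hf : Submodule ℚ_[p] H1) : Set H1)
  rw [D.He_eq_Hf]

/-- **The Perrin-Riou step DISCHARGED over the bridge**: Kummer classes of 1-units lie in `H¹_f` (E-t19's
`kummer_mem_Hf_iff_norm`: exactly the unit classes do). [folklore] -/
theorem oneUnitsKummerFontaine_ofBlochKato : (LocalBKDatum.ofBlochKato D).OneUnitsKummerFontaine := by
  intro u hu
  have h1 : ‖u‖ = 1 := by
    have h := oneUnits_subset_sphere hu; rwa [mem_sphere, dist_zero_right] at h
  have h0 : u ≠ 0 := fun h => by rw [h, norm_zero] at h1; exact zero_ne_one h1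
  show (kummerZ D u : H1) ∈ ((D.Hf : Submodule ℚ_[p] H1) : Set H1)
  rw [kummerZ_of_ne_zero D h0]
  exact (D.kummer_mem_Hf_iff_norm _).2 (by exact h1)

/-- **p.111 l.1–12 DISCHARGED over the bridge**: principal units have classes in `H¹_e(G, ℤ_p(1))`. [folklore] -/
theorem principalUnitsCrystalline_ofBlochKato : (LocalBKDatum.ofBlochKato D).PrincipalUnitsCrystalline := by
  intro u hu
  have h1 : ‖u‖ = 1 := norm_eq_one_of_mem_closedBall_pstar hu
  have h0 : u ≠ 0 := fun h => by rw [h, norm_zero] at h1; exact zero_ne_one h1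
  show (kummerZ D u : H1) ∈ ((D.He : Submodule ℚ_[p] H1) : Set H1)
  rw [kummerZ_of_ne_zero D h0]
  exact (D.kummer_mem_He_iff_norm _).2 (by exact h1)

/-- **NORMALISATION TENSION, general form** (neutral flag): over the bridged datum the general form of (9.7.2.2),
«`log_BK(ξ) = log_p(ξ)/p*_w` for `ξ ≡ 1 mod p*`» (this seat's claim `LogBKPrincipalUnits`), is FALSE — (9.1.1.3) gives
`log_BK = log_p` on unit classes, and the principal unit `u` with `log_p(u) = p*` (it exists: `log_p(1 + p*𝒪) = p*𝒪`) would need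
`p* = 1`. [folklore] -/
theorem not_logBKPrincipalUnits_ofBlochKato : ¬ (LocalBKDatum.ofBlochKato D).LogBKPrincipalUnits := by
  intro h
  set L := PadicLogOnUnits.ofUnitLog p E with hL
  have hmem : L.pstar ∈ closedBall (0 : E) ‖L.pstar‖ := by simp [mem_closedBall]
  rw [← L.image_principalUnits] at hmem
  obtain ⟨u, hu, hlog⟩ := hmem
  have h1 : ‖u‖ = 1 := norm_eq_one_of_mem_closedBall_pstar hu
  have he := principalUnitsCrystalline_ofBlochKato D u hu
  have hform := h u hu he
  rw [logBK_ofBlochKato_kummer D h1 he] at hform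
  have hlog' : unitLog u = L.pstar := by simpa [hL] using hlog
  have hps : L.pstar = 1 := by
    have : unitLog u = L.pstar⁻¹ * L.log u := hform
    rw [show L.log u = unitLog u from rfl, hlog', inv_mul_cancel₀ L.pstar_ne_zero] at this
    exact this
  have hn := L.norm_pstar_lt_one
  rw [hps, norm_one] at hn
  exact lt_irrefl _ hn

/-! ### The Tate datum over the bridge: Lemma 9.6.2.2 discharged, (9.7.2.2)'s membership kept, its displayed value refuted -/

variable (hp2 : p ≠ 2) (l : ℕ) (hl : 1 ≤ l) (q2l : E) (hq0 : q2l ≠ 0) (hq1 : ‖q2l‖ < 1)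

/-- The Tate datum of 9.6.2 at `w ∈ V^{odd,ss}_p` over the bridged local datum (given `ℓ` and the root `q^{1/2ℓ} ∈ 𝔪 ∖ 0`).
[claim: Joshi2024ATS3, status: disputed] -/
@[claim "Joshi2024ATS3" "disputed"]
def TateLocalDatum.ofBlochKato : TateLocalDatum E (↥D.HZ) H1 where
  toLocalBKDatum := LocalBKDatum.ofBlochKato D
  p_ne_two := hp2
  l := l
  one_le_l := hl
  q2l := q2l
  q2l_ne_zero := hq0
  norm_q2l_lt_one := hq1

/-- **Lemma 9.6.2.2 DISCHARGED over the bridge**: `ξ_w = κ(1 + p*·q^{1/2ℓ}) ∈ H¹_e(G_{L′_w};K_w, ℤ_p(1))` ([J-III] p.109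
l.62–p.110 l.6), from E-t19's (9.1.1.3)/(9.1.1.4) fields. [folklore] -/
theorem xiCrystalline_ofBlochKato : (TateLocalDatum.ofBlochKato D hp2 l hl q2l hq0 hq1).XiCrystalline :=
  (TateLocalDatum.ofBlochKato D hp2 l hl q2l hq0 hq1).xiCrystalline_of_principalUnitsCrystalline
    (principalUnitsCrystalline_ofBlochKato D)

/-- Over the bridge, `log_BK(ξ_w) = log_p(1 + p*·q^{1/2ℓ})` (no `1/p*_w`). [folklore] -/
theorem logBK_xi_ofBlochKato :
    (LocalBKDatum.ofBlochKato D).logBK ⟨_, xiCrystalline_ofBlochKato D hp2 l hl q2l hq0 hq1⟩ =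
      unitLog (TateLocalDatum.ofBlochKato D hp2 l hl q2l hq0 hq1).tateOneUnit :=
  logBK_ofBlochKato_kummer D (norm_eq_one_of_mem_closedBall_pstar
    (TateLocalDatum.ofBlochKato D hp2 l hl q2l hq0 hq1).tateOneUnit_mem_closedBall) _

/-- **The MEMBERSHIP half of (9.7.2.2) / Prop. 9.7.2.3 holds over the bridge**: `log_BK(ξ_w) = log_p(1 + p*·q^{1/2ℓ})` lies in
`p*·𝒪 ⊆ 𝒪 ⊆ ℐ = I((X/L′_w, K_w))` ([J-III] p.110 l.74–75, p.111 l.28–30). [cite: MochizukiAbsTopIII2015, Def 5.4 (iii) p. 126] -/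
theorem logBK_xi_mem_logShell_ofBlochKato :
    (LocalBKDatum.ofBlochKato D).logBK ⟨_, xiCrystalline_ofBlochKato D hp2 l hl q2l hq0 hq1⟩ ∈
      logShell (PadicLogOnUnits.ofUnitLog p E) := by
  set T := TateLocalDatum.ofBlochKato D hp2 l hl q2l hq0 hq1
  rw [logBK_xi_ofBlochKato]
  refine closedBall_subset_logShell (PadicLogOnUnits.ofUnitLog p E) ?_
  have h := T.norm_log_le_of_mem_closedBall T.tateOneUnit_mem_closedBall
  rw [mem_closedBall, dist_zero_right]
  exact h.trans (PadicLogOnUnits.ofUnitLog p E).norm_pstar_lt_one.le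

/-- **NORMALISATION TENSION at `ξ_w`** (neutral flag): over the bridge the displayed value of (9.7.2.2),
«`log_BK(ξ) = log_p(1 + p*_w·q^{1/2ℓ})/p*_w`» (this seat's claim `LogBKXiFormula`), is FALSE: it forces
`log_p(1 + p*·q^{1/2ℓ}) = 0`, hence (injectivity of `log_p` on `1 + p*𝒪`, `log_p(1) = 0`) `q^{1/2ℓ} = 0`. [folklore] -/
theorem not_logBKXiFormula_ofBlochKato : ¬ (TateLocalDatum.ofBlochKato D hp2 l hl q2l hq0 hq1).LogBKXiFormula := by
  set T := TateLocalDatum.ofBlochKato D hp2 l hl q2l hq0 hq1 with hT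
  set L := PadicLogOnUnits.ofUnitLog p E with hL
  rintro ⟨he, hval⟩
  have hlog : T.logBK ⟨_, he⟩ = unitLog T.tateOneUnit := logBK_xi_ofBlochKato D hp2 l hl q2l hq0 hq1
  rw [hlog] at hval
  -- hval : unitLog (1 + p*·q) = p*⁻¹ * log_p (1 + p*·q)
  have hval' : unitLog T.tateOneUnit = L.pstar⁻¹ * unitLog T.tateOneUnit := hval
  have hp1 : L.pstar⁻¹ ≠ 1 := by
    intro h1
    have hn := L.norm_pstar_lt_one
    rw [inv_eq_one] at h1
    rw [h1, norm_one] at hn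
    exact lt_irrefl _ hn
  have hzero : unitLog T.tateOneUnit = 0 := by
    have h2 : (1 - L.pstar⁻¹) * unitLog T.tateOneUnit = 0 := by rw [sub_mul, one_mul, ← hval', sub_self]
    rcases mul_eq_zero.1 h2 with h3 | h3
    · exact absurd (sub_eq_zero.1 h3).symm hp1
    · exact h3
  have hinj := L.injOn_principalUnits T.tateOneUnit_mem_closedBall (mem_closedBall_self (norm_nonneg _))
    (by rw [show L.log = unitLog from rfl, hzero, unitLog_one p])
  -- hinj : 1 + p*·q = 1
  have hq : L.pstar * q2l = 0 := by
    have : (1 : E) + L.pstar * q2l = 1 := hinj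
    simpa using this
  rcases mul_eq_zero.1 hq with h | h
  · exact L.pstar_ne_zero h
  · exact hq0 h

end Bridge

end Summit.ABC.IUTFork.Joshi.ATS3

end
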